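import Mathlib
import Summits.HodgeConjecture.FermatCycles.HodgeFermatCorollaryUSharp
import Summits.HodgeConjecture.FermatCycles.HodgeFermatLemmaWk
import Summits.HodgeConjecture.FermatCycles.HodgeFermatCorollaryUStatement

/-!
# COROLLARY U′ with the PRINTED thresholds `1/s(N)` and `1/U(N)` — unconditional (`HodgeFermat/CorollaryUSharpFinal.lean`; HF-G27b); closes the statements `CorUSharpS`, `CorUSharpU`

Tree copy of the module `HodgeFermat/CorollaryUSharpFinal.lean` of the sibling cell's standalone package
`run/shared/lean/pub/pub-hodgefermat/lean/HodgeFermat/` (106 lines, sha256 `b476eebb06864705…`), source lines 35–77 and 89–98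
(`evenAtK_of_badCount`, `isSumOfPairs_of_badCount` — threshold `1/s(N)` —, `evenAtK_of_tauP`, `isSumOfPairs_of_tauP`, `reach_of_tauP`
— threshold `1/U(N)` —, `corUSharpS : CorUSharpS`, `corUSharpU : CorUSharpU`, `corUSharpU_of_S`) — pub-hodgefermat `CERT.md` l.915, GATE HF-G27b;
cell record the link check `check/CorUSharpLink_standalone.lean` (`--axioms corUSharpS` = the trio + exactly `LemmaWSupp.lemmaWk_of_badCount`,
`--axioms corUSharpU` adds exactly `BadCountBound.badCount_lt_of_tauP` — both theorems of `HodgeFermatLemmaWk.lean`).  The statements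
`CorUSharpS`/`CorUSharpU` (source l.79–87) were filed first (`HodgeFermatCorollaryUStatement.lean`, same namespace).
Filed by cell `pub-hfermat`, seat prover-1 gen-5, on the COORDINATOR KEEPER RULING of 2026-08-25 (gem sweep H1: take the
off-gate kernel theorem `thmFstar` through the gate; every form of THEOREM F* is on-gate since 2026-08-25/26, gen-0/2/3/4), as
successor work of the same verbatim-port kind: the sibling's off-gate gate records HF-G27 / HF-G27b / HF-G27c — COROLLARY U′
(all-unit Hodge multisets with few distinct residues are sums of pairs), its printed-threshold forms U♯, and THEOREM U in
shared-entry form — on top of the landed LEMMA W / THEOREM U / U⁺ / U⁼ chain (`HodgeFermatTheoremU.lean`,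
`HodgeFermatLemmaWFourier.lean`, `HodgeFermatTheoremUPlus.lean`, `HodgeFermatTheoremUEq.lean`, `HodgeFermatPropDPrimeNFinal.lean`).
Deviations from the source module, exhaustively: the `import` lines (`…HodgeFermatCorollaryUSharp`; `…HodgeFermatLemmaWk` for
`import HodgeFermat.LemmaWkFourier` and `import HodgeFermat.BadCountBound`, both landed inside that multi-module file; the source's
`import HodgeFermat.HypUPlusFinal` served only the dropped `corUPrime_again` — `HypUPlus.tauP` comes with `HodgeFermatLemmaWk.lean`;
`…HodgeFermatCorollaryUStatement` for the two definitions filed first, NOT re-declared here); this docstring (replacing the module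
docstring, quoted below); one-line docstrings added (gate lint) to `corUSharpS`, `corUSharpU`; ONE DEDUP deletion (pre-empting the
gate's `dedup.landed`; the source's own «is the instance k = 6» re-derivation, used nowhere): `theorem corUPrime_again : CorUPrime`
(source l.100–104) restates `HodgeFermat.KRFree.CorollaryUPrime.corUPrime` (`HodgeFermatCorollaryUPrimeFinal.lean`).  Every other line —
in particular every declaration's statement and proof — is byte-identical to the source.
Trust base: no hypotheses in `corUSharpS` / `corUSharpU` beyond their displayed threshold inequalities, no `sorry`;
axioms = [propext, Classical.choice, Quot.sound].
HONEST FRAMING: explicit algebraic cycles for specific Hodge classes on Fermat/Delsarte varieties; residual open instances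
listed; no claim on general Hodge.  (This file is arithmetic of CM types / finite combinatorics of the sibling's KR-free
programme; it claims nothing about cycles.)

The docstring of `HodgeFermat/CorollaryUSharpFinal.lean` (l.9–33), verbatim:

## COROLLARY U′ with the PRINTED thresholds `1/s(N)` and `1/U(N)` — unconditional (HF-G27b)

`tables/SEMI-THEOREM.md` §2, COROLLARY U′: "let `v ∈ K(m)` be supported on units; if `#supp(v) < 1/s(m)` then `v` is a
sum of pairs … and since `s(m) ≤ U(m) → 0`, all-unit Hodge cycles with fewer than `1/U(m) ≍ log m` distinct residues are
sums of pairs".  Dictionary: `s(N) = #{bad odd χ} / (φ(N)/2) = badCount N / (φ(N)/2)` (`LemmaWFourier.badCount`), so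
`#supp < 1/s(N)` ⟺ `2 · #supp · badCount N < φ(N)`; `U(N) = (Σ_{p ∣ N} τ⁺(N,p)) / φ(N)` (`HypUPlus.tauP`), so
`#supp < 1/U(N)` ⟺ `#supp · Σ_p tauP N p < φ(N)`.  With these readings, at EVERY ODD level `N` (no exception: the
hypothesis is the actual inequality; `N = 1` is vacuous):

* `isSumOfPairs_of_badCount` / `corUSharpS` — threshold `1/s(N)`: an all-unit Hodge multiset with at most `k` distinct
  residues, `2·k·badCount N < φ(N)`, is a sum of pairs `{a, −a}` (`LemmaWkFourier.lemmaWk_of_badCount` with support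
  bound `2k` + `CorollaryUSharp.isSumOfPairs_odd`); weight form `evenAtK_of_badCount` (signed weights, = `v ∈ K(N)`);
* `isSumOfPairs_of_tauP` / `corUSharpU` — threshold `1/U(N)`: the same under `k · Σ_p tauP N p < φ(N)`
  (`BadCountBound.badCount_lt_of_tauP`, i.e. `s(N) ≤ U(N)`); weight form `evenAtK_of_tauP`;
* `corUPrime_again : CorUPrime` — generation 27's threshold-6 corollary recovered as the instance `k = 6` of the
  `1/U(N)` form and LEMMA S⁺ (`HypUPlus.goodOddP` : `6 · Σ_p tauP N p < φ(N)` at odd `N > 1`, `N ∉ {21, 39}`).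

Hub records: `check/LemmaWk_standalone.lean` (`lemmaWk_of_badCount`), `check/CorUSharp_standalone.lean` (`isSumOfPairs_odd`),
`check/BadCountBound_standalone.lean` (`badCount_lt_of_tauP`), and the link check `check/CorUSharpLink_standalone.lean`
(this module verbatim over those three statements postulated: `--axioms corUSharpS` = the three + exactly
`LemmaWSupp.lemmaWk_of_badCount`; `--axioms corUSharpU` adds exactly `BadCountBound.badCount_lt_of_tauP`; `corUPrime_again`
adds generation 26's `HypUPlus.goodOddP`).  What remains by hand in §2: only the inclusion–exclusion VALUES `s(21) = 1/6`,
`s(39) = 1/4`, `s(m) ≤ 3/20` (the kernel bounds `s` by `U` and never evaluates `s` itself).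
-/

set_option autoImplicit false

namespace HodgeFermat.KRFree.CorollaryUSharp

open Finset HodgeFermat.KRFree.TheoremU HodgeFermat.KRFree.LemmaWSupp HodgeFermat.KRFree.LemmaWFourier
open HodgeFermat.KRFree.HypUPlus HodgeFermat.KRFree.BadCountBound HodgeFermat.KRFree.CorollaryUPrime
open Literature.AlgebraicGeometry.HodgeTheory.FermatCharacter

/-! ## Threshold `1/s(N)` -/

/-- **COROLLARY U′, threshold `1/s(N)`, weight form**: at a level `N > 1`, an integer weight on the units of `ℤ/N` with at
most `k` non-zero values, `2·k·#bad(N) < φ(N)`, which satisfies the Hodge length equations at every unit, is even. -/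
theorem evenAtK_of_badCount (N k : ℕ) (h1 : 1 < N) (hbad : 2 * k * badCount N < N.totient) : EvenAtK N k :=
  evenAtK_of_lemmaWk h1 (lemmaWk_of_badCount h1 hbad)

/-- **COROLLARY U′, threshold `1/s(N)`**: at an odd level `N`, an all-unit Hodge multiset with at most `k` distinct
residues, where `2·k·#bad(N) < φ(N)`, is a sum of pairs `{a, −a}`. -/
theorem isSumOfPairs_of_badCount (N k : ℕ) (hodd : ¬ 2 ∣ N) (hbad : 2 * k * badCount N < N.totient)
    {s : Multiset (ZMod N)} (hs : IsHodgeMultiset s) (hu : ∀ a ∈ s, IsUnit a) (hk : s.toFinset.card ≤ k) :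
    IsSumOfPairs s :=
  isSumOfPairs_odd N k hodd (fun h1 => lemmaWk_of_badCount h1 hbad) hs hu hk

/-! ## Threshold `1/U(N)` -/

/-- **COROLLARY U′, threshold `1/U(N)`, weight form.** -/
theorem evenAtK_of_tauP (N k : ℕ) (h1 : 1 < N) (hU : k * ∑ p ∈ N.primeFactors, tauP N p < N.totient) :
    EvenAtK N k :=
  evenAtK_of_lemmaWk h1 (lemmaWk_of_badCount h1 (badCount_lt_of_tauP N k h1 hU))

/-- **COROLLARY U′, threshold `1/U(N)`**: at an odd level `N`, an all-unit Hodge multiset with at most `k` distinct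
residues, where `k · Σ_{p ∣ N} τ⁺(N,p) < φ(N)`, is a sum of pairs `{a, −a}`. -/
theorem isSumOfPairs_of_tauP (N k : ℕ) (hodd : ¬ 2 ∣ N) (hU : k * ∑ p ∈ N.primeFactors, tauP N p < N.totient)
    {s : Multiset (ZMod N)} (hs : IsHodgeMultiset s) (hu : ∀ a ∈ s, IsUnit a) (hk : s.toFinset.card ≤ k) :
    IsSumOfPairs s :=
  isSumOfPairs_odd N k hodd (fun h1 => lemmaWk_of_badCount h1 (badCount_lt_of_tauP N k h1 hU)) hs hu hk

/-- … hence ℤ-reachable from the printed supply of its own level (pairs only). -/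
theorem reach_of_tauP (N k : ℕ) (hodd : ¬ 2 ∣ N) (hU : k * ∑ p ∈ N.primeFactors, tauP N p < N.totient)
    {s : Multiset (ZMod N)} (hs : IsHodgeMultiset s) (hu : ∀ a ∈ s, IsUnit a) (hk : s.toFinset.card ≤ k) :
    Reach N s :=
  reach_of_isSumOfPairs (isSumOfPairs_of_tauP N k hodd hU hs hu hk)

/-! ## The two printed statements as propositions, and generation 27's threshold 6 as an instance -/

-- `def CorUSharpS`, `def CorUSharpU` (source l.79–87): filed first, `HodgeFermatCorollaryUStatement.lean` (same namespace).

/-- **COROLLARY U′ with threshold `1/s(N)`** — no hypotheses beyond the inequality. -/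
theorem corUSharpS : CorUSharpS := fun N k hodd hbad _ hs hu hk => isSumOfPairs_of_badCount N k hodd hbad hs hu hk

/-- **COROLLARY U′ with threshold `1/U(N)`** — no hypotheses beyond the inequality. -/
theorem corUSharpU : CorUSharpU := fun N k hodd hU _ hs hu hk => isSumOfPairs_of_tauP N k hodd hU hs hu hk

/-- the `1/s` form implies the `1/U` form (`s ≤ U`). -/
theorem corUSharpU_of_S (h : CorUSharpS) : CorUSharpU := by
  intro N k hodd hU s hs hu hk
  rcases Nat.lt_or_ge 1 N with h1 | hN1
  · exact h N k hodd (badCount_lt_of_tauP N k h1 hU) s hs hu hk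
  · exact isSumOfPairs_odd N k hodd (fun h1 => absurd h1 (by omega)) hs hu hk

-- `theorem corUPrime_again : CorUPrime` (source l.100–104, «the instance `k = 6` of the `1/U(N)` form»): NOT re-declared — its
-- statement is `HodgeFermat.KRFree.CorollaryUPrime.corUPrime` of `HodgeFermatCorollaryUPrimeFinal.lean` (DEDUP).

end HodgeFermat.KRFree.CorollaryUSharp
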